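import Summits.CriticalPhenomena.Ising3D.Control2DIndexL11
import HarnessLib

/-!
# The Λ = 13 index list of the 2D γ-certificates
(cell `pub-ising3x`, seat controls-1 gen 17; KERNEL PATH for the 2D γ-certificates, Λ = 13 — CONTROL-ONLY scaffolding)

HONEST FRAMING: lottery ticket; floor = tightest certified 3D Ising CFT bounds; no exact-solution
claim without a proof. Nothing about any CFT is asserted here.

Every Λ = 13 derivative functional of the cell (RB-2 box certificates `j110356`, `j110357`, `j111516`,
`j111517` …; format `deriv-functional-2d/2`) is a table on the same 28 pairs `(m, n)` with `m > n`,
`m + n` odd `≤ 13` (the certificates' `index_set`, in their order): the Λ = 11 list `slL11` followed by the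
seven pairs with `m + n = 13`. Shared by all Λ = 13 table / cells / assembly files.
-/

namespace Summit.CriticalPhenomena.Ising3D.Control2D

/-- The Λ = 13 index list: the 28 pairs `(m, n)`, `m > n`, `m + n` odd `≤ 13` (= `slL11` followed by the
pairs with `m + n = 13`). [folklore] -/
def slL13 : List (ℕ × ℕ) := [(1, 0), (3, 0), (2, 1), (5, 0), (4, 1), (3, 2), (7, 0), (6, 1), (5, 2), (4, 3),
  (9, 0), (8, 1), (7, 2), (6, 3), (5, 4), (11, 0), (10, 1), (9, 2), (8, 3), (7, 4), (6, 5),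
  (13, 0), (12, 1), (11, 2), (10, 3), (9, 4), (8, 5), (7, 6)]

/-- [folklore] -/
theorem slL13_nodup : slL13.Nodup := by decide

/-- [folklore] -/
theorem slL13_deg : ∀ p ∈ slL13, p.1 + p.2 ≤ 13 := by decide

/-- `slL13` extends `slL11`. [folklore] -/
theorem slL13_eq_append : slL13 = slL11 ++ [(13, 0), (12, 1), (11, 2), (10, 3), (9, 4), (8, 5), (7, 6)] := rfl

end Summit.CriticalPhenomena.Ising3D.Control2D
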